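import Mathlib
import Literature.AlgebraicGeometry.Resolution.CobordantGame
import Literature.AlgebraicGeometry.Resolution.CobordantTupleGame
import Literature.AlgebraicGeometry.Resolution.FormalCoordinateChange
import Literature.AlgebraicGeometry.Resolution.FormalInverseFunction
import Summits.ResolutionOfSingularities.ResolutionOfSingularities.Theorems.WeightedInvariantLocalWeightedDropConeDichotomyAux
import Summits.ResolutionOfSingularities.ResolutionOfSingularities.Theorems.WeightedInvariantLocalWeightedDropCriticalSection
import Summits.ResolutionOfSingularities.ResolutionOfSingularities.Theorems.WeightedInvariantLocalWeightedDropTschirnhausFormAux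

/-!
# The Tschirnhaus (maximal contact) form of a germ of tame multiplicity

Crux `LocalWeightedDrop` (stmt-ResolutionOfSingularities-8899, route ResolutionOfSingularities/WeightedInvariant),
line `hasse-ridge-face-selection`, registered stub `stub_tschirnhausForm` of the skeleton `LocalWeightedDrop`.
Over an algebraically closed field `k` of characteristic `p`, a singular germ `f ∈ k[[x_0, …, x_m]]` of order
`d = e + 2` with `p ∤ d` becomes, after a legal formal coordinate change `θ`, a PREPARED germ
`TupleGame.germ U a = U · y^{e+2} + Σ_{j ≤ e} a_j(x') · y^j` (`y = X (Fin.last m)`, `U(0) ≠ 0`, no `y^{e+1}`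
term) with a bad coefficient tuple `a` (`TupleGame.Bad`).  No Weierstrass preparation is used.

Proof.
1. `y`-REGULARITY (`exists_linSubst_coeff_ne_zero`): the degree-`d` form `Q` of `f` is a non-zero polynomial,
   `k` is infinite, so `Q(v) · v_y ≠ 0` for some `v` (`MvPolynomial.funext`); for the matrix `M` = identity with
   last column `v` (`det M = v_y`) the `y^d` coefficient of `F = f ∘ (x ↦ Mx)` is read off on the `y`-axis
   `x ↦ (v_i y)_i`, where it is `Q(v)` (`TschirnhausForm.coeff_single_subst_smul_X`).
2. THE SHEAR (`exists_shear_germ`): the Hasse derivative `P = ∂_y^{(e+1)} F` has `P(0) = 0` and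
   `∂_y P(0) = (e+2) · F_{(e+2) e_y} ≠ 0`, so `Ψ = (x', P)` is a formal coordinate change; its inverse `Ξ`
   (`FormalCoordChange.exists_comp_inverse`) has `P ∘ Ξ = y`, and killing `y` gives a `y`-free `φ ∈ 𝔪` with
   `P(x', φ) = 0`.  By the Hasse slice (`TschirnhausForm.coeff_shear_slice`) the shear `τ = (x', y + φ)` kills
   the whole `y^{e+1}`-slice of `G = F ∘ τ`, while the pure `y`-coefficients are unchanged (restrict to the
   `y`-axis).  Collect `U = Σ_{n ≥ e+2} G_{·,n} y^{n-e-2}` and `a_j = G_{·,j}` (`j ≤ e`); `Bad a` from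
   `ord G ≥ e + 2`.
3. COMPOSE: `θ = τ ∘ (x ↦ Mx)`, with linear part `M · T`, `T` unipotent (`TschirnhausForm.linMat_subst`).
-/

set_option linter.dupNamespace false -- mandated namespace of this single-conjunct summit

namespace Summit.ResolutionOfSingularities.ResolutionOfSingularities.Theorems

open Literature.AlgebraicGeometry.Resolution

namespace TschirnhausForm

open MvPowerSeries

variable {k : Type} [Field k] {m : ℕ}

/-! ### Step 1: `y`-regularity by a linear change -/

/-- `y`-REGULARITY.  For a non-zero germ `f` of order `d` over an infinite field there is an invertible matrix `M`
(the identity with its last column replaced by a suitable `v`, `det M = v_y ≠ 0`) such that `f ∘ (x ↦ Mx)` has a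
non-zero `y^d` coefficient (namely the value `Q(v)` of the degree-`d` form of `f`). -/
theorem exists_linSubst_coeff_ne_zero [Infinite k] (f : MvPowerSeries (Fin (m + 1)) k) (hf : f ≠ 0) {d : ℕ}
    (hfd : f.order = d) :
    ∃ M : Matrix (Fin (m + 1)) (Fin (m + 1)) k, IsUnit M.det ∧
      coeff (Finsupp.single (Fin.last m) d) (subst (FormalCoordChange.linSubst M) f) ≠ 0 := by
  classical
  -- the degree-`d` form `Q` of `f` is a non-zero polynomial
  set S := (Finset.univ : Finset (Fin (m + 1))).finsuppAntidiag d with hS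
  set Q : MvPolynomial (Fin (m + 1)) k := ∑ α ∈ S, MvPolynomial.monomial α (coeff α f) with hQ
  obtain ⟨α₀, hα₀, hdeg₀⟩ := exists_coeff_ne_zero_and_order (f := f) (ne_zero_iff_order_finite.mp hf)
  have hdeg₀' : α₀.degree = d := by
    rw [hfd] at hdeg₀
    exact_mod_cast hdeg₀
  have hQne : Q ≠ 0 := by
    intro h
    have h1 : Q.coeff α₀ = coeff α₀ f := by
      rw [hQ, MvPolynomial.coeff_sum, Finset.sum_eq_single α₀]
      · rw [MvPolynomial.coeff_monomial, if_pos rfl]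
      · intro α _ hne
        rw [MvPolynomial.coeff_monomial, if_neg hne]
      · intro hα₀S
        exfalso
        apply hα₀S
        rw [Finset.mem_finsuppAntidiag, ← Finsupp.degree_eq_sum]
        exact ⟨hdeg₀', Finset.subset_univ _⟩
    rw [h, MvPolynomial.coeff_zero] at h1
    exact hα₀ h1.symm
  -- `k` is infinite: `Q(v) · v_y ≠ 0` for some `v`
  have hQX : Q * MvPolynomial.X (Fin.last m) ≠ 0 := mul_ne_zero hQne (MvPolynomial.X_ne_zero _)
  obtain ⟨v, hv⟩ : ∃ v : Fin (m + 1) → k, MvPolynomial.eval v (Q * MvPolynomial.X (Fin.last m)) ≠ 0 := by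
    by_contra h
    push Not at h
    exact hQX (MvPolynomial.funext fun v => by rw [h v, map_zero])
  rw [map_mul, MvPolynomial.eval_X] at hv
  have hvQ : MvPolynomial.eval v Q ≠ 0 := left_ne_zero_of_mul hv
  have hvy : v (Fin.last m) ≠ 0 := right_ne_zero_of_mul hv
  have hev : MvPolynomial.eval v Q = ∑ α ∈ S, coeff α f * α.prod fun i n => v i ^ n := by
    rw [hQ, map_sum]
    exact Finset.sum_congr rfl fun α _ => MvPolynomial.eval_monomial
  -- the matrix: identity with last column `v`
  obtain ⟨M, hM⟩ : ∃ M : Matrix (Fin (m + 1)) (Fin (m + 1)) k,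
      ∀ i j, M i j = if j = Fin.last m then v i else if i = j then 1 else 0 :=
    ⟨Matrix.of fun i j => if j = Fin.last m then v i else if i = j then 1 else 0, fun _ _ => rfl⟩
  have hdet : M.det = v (Fin.last m) := by
    rw [← Matrix.det_transpose, det_of_offLast_rows]
    · rw [Matrix.transpose_apply, hM, if_pos rfl]
    · intro i j hi
      rw [Matrix.transpose_apply, hM, if_neg hi]
  refine ⟨M, by rw [hdet]; exact isUnit_iff_ne_zero.mpr hvy, ?_⟩
  -- read the `y^d` coefficient on the `y`-axis `π = (0, …, 0, y)`
  obtain ⟨π, hπ⟩ : ∃ π : Fin (m + 1) → MvPowerSeries (Fin (m + 1)) k,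
      ∀ i, π i = if i = Fin.last m then X i else 0 := ⟨_, fun _ => rfl⟩
  have hπs : HasSubst π := CriticalSection.hasSubst_indSubst hπ
  have hsupp : ∀ i ∈ (Finsupp.single (Fin.last m) d).support, i = Fin.last m := fun i hi =>
    Finset.mem_singleton.mp (Finsupp.support_single_subset hi)
  have h1 := CriticalSection.coeff_subst_indSubst_of_forall hπ (subst (FormalCoordChange.linSubst M) f) hsupp
  have h2 : subst π (subst (FormalCoordChange.linSubst M) f) =
      subst (fun i => v i • (X (Fin.last m) : MvPowerSeries (Fin (m + 1)) k)) f := by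
    rw [subst_comp_subst_apply (FormalCoordChange.hasSubst_linSubst M) hπs]
    congr 1
    funext i
    rw [FormalCoordChange.subst_linSubst_apply hπs, Finset.sum_eq_single (Fin.last m)]
    · rw [hπ, if_pos rfl, hM, if_pos rfl]
    · intro j _ hj
      rw [hπ, if_neg hj, smul_zero]
    · intro h
      exact absurd (Finset.mem_univ _) h
  rw [← h1, h2, coeff_single_subst_smul_X, ← hev]
  exact hvQ

/-! ### Step 2: the shear along the Hasse hypersurface and the collection -/

/-- THE SHEAR AND THE COLLECTION.  If `e + 2 ≤ ord F`, the `y^{e+2}` coefficient `c` of `F` is non-zero and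
`e + 2 ≠ 0` in `k`, then for some `y`-free `φ ∈ 𝔪` the shear `τ = (x', y + φ)` carries `F` to a prepared germ
`TupleGame.germ U a` with `U(0) ≠ 0` (indeed `= c`) and `a` bad. -/
theorem exists_shear_germ (e : ℕ) (he : ((e + 2 : ℕ) : k) ≠ 0) (F : MvPowerSeries (Fin (m + 1)) k)
    (hFo : ((e + 2 : ℕ) : ℕ∞) ≤ F.order) (hc : coeff (Finsupp.single (Fin.last m) (e + 2)) F ≠ 0) :
    ∃ (φ : MvPowerSeries (Fin (m + 1)) k) (τ : Fin (m + 1) → MvPowerSeries (Fin (m + 1)) k)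
      (U : MvPowerSeries (Fin (m + 1)) k) (a : Fin (e + 1) → MvPowerSeries (Fin m) k),
      (∀ E : Fin (m + 1) →₀ ℕ, E (Fin.last m) ≠ 0 → coeff E φ = 0) ∧ constantCoeff φ = 0 ∧
      (∀ i, τ i = if i = Fin.last m then X (Fin.last m) + φ else X i) ∧
      constantCoeff U ≠ 0 ∧ TupleGame.Bad a ∧ subst τ F = TupleGame.germ U a := by
  classical
  -- the Hasse derivative `P = ∂_y^{(e+1)} F`: `P(0) = 0`, `∂_y P(0) = (e+2)·c ≠ 0`
  obtain ⟨P, hP⟩ : ∃ P : MvPowerSeries (Fin (m + 1)) k, ∀ E : Fin (m + 1) →₀ ℕ, coeff E P =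
      ((E (Fin.last m) + (e + 1)).choose (e + 1) : k) * coeff (E + Finsupp.single (Fin.last m) (e + 1)) F :=
    ⟨fun E => ((E (Fin.last m) + (e + 1)).choose (e + 1) : k) * coeff (E + Finsupp.single (Fin.last m) (e + 1)) F,
      fun _ => rfl⟩
  have hP0 : constantCoeff P = 0 := by
    rw [← coeff_zero_eq_constantCoeff_apply, hP, zero_add, coeff_of_lt_order, mul_zero]
    rw [Finsupp.degree_single]
    exact lt_of_lt_of_le (by exact_mod_cast Nat.lt_succ_self (e + 1)) hFo
  have hP1 : coeff (Finsupp.single (Fin.last m) 1) P ≠ 0 := by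
    rw [hP, Finsupp.single_eq_same, ← Finsupp.single_add, show 1 + (e + 1) = e + 1 + 1 by ring,
      Nat.choose_succ_self_right]
    exact mul_ne_zero he hc
  -- `Ψ = (x', P)` is a formal coordinate change; its inverse `Ξ` straightens `P`: `P ∘ Ξ = y`
  obtain ⟨Ψ, hΨ⟩ : ∃ Ψ : Fin (m + 1) → MvPowerSeries (Fin (m + 1)) k,
      ∀ i, Ψ i = if i = Fin.last m then P else X i := ⟨_, fun _ => rfl⟩
  have hΨ0 : ∀ i, constantCoeff (Ψ i) = 0 := fun i => by
    rw [hΨ]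
    split_ifs
    · exact hP0
    · exact constantCoeff_X i
  have hΨdet : IsUnit (FormalCoordChange.linMat Ψ).det := by
    rw [FormalCoordChange.linMat, det_of_offLast_rows]
    · rw [Matrix.of_apply, hΨ, if_pos rfl]
      exact isUnit_iff_ne_zero.mpr hP1
    · intro i j hi
      rw [Matrix.of_apply, hΨ, if_neg hi, coeff_index_single_X]
  obtain ⟨Ξ, hΞ0, hΞΨ, -⟩ := FormalCoordChange.exists_comp_inverse hΨ0 hΨdet
  have hΞs : HasSubst Ξ := hasSubst_of_constantCoeff_zero hΞ0
  have hΞX : ∀ i, i ≠ Fin.last m → Ξ i = X i := fun i hi => by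
    have h := hΞΨ i
    rwa [hΨ, if_neg hi, subst_X hΞs] at h
  have hΞP : subst Ξ P = X (Fin.last m) := by
    have h := hΞΨ (Fin.last m)
    rwa [hΨ, if_pos rfl] at h
  -- kill `y`: `φ = Ξ_y(x', 0)` is `y`-free, in `𝔪`, and `P(x', φ) = 0`
  obtain ⟨κ, hκ⟩ : ∃ κ : Fin (m + 1) → MvPowerSeries (Fin (m + 1)) k,
      ∀ i, κ i = if i ≠ Fin.last m then X i else 0 := ⟨_, fun _ => rfl⟩
  have hκs : HasSubst κ := CriticalSection.hasSubst_indSubst hκ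
  set φ := subst κ (Ξ (Fin.last m)) with hφdef
  have hφ0 : constantCoeff φ = 0 :=
    constantCoeff_subst_eq_zero hκs (CriticalSection.constantCoeff_indSubst hκ) (hΞ0 _)
  have hφy : ∀ E : Fin (m + 1) →₀ ℕ, E (Fin.last m) ≠ 0 → coeff E φ = 0 := fun E hE =>
    CriticalSection.coeff_subst_indSubst_of_not hκ _ hE (fun h => h rfl)
  obtain ⟨ρ, hρ⟩ : ∃ ρ : Fin (m + 1) → MvPowerSeries (Fin (m + 1)) k,
      ∀ i, ρ i = if i = Fin.last m then φ else X i := ⟨_, fun _ => rfl⟩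
  have hρΞ : (fun i => subst κ (Ξ i)) = ρ := by
    funext i
    rw [hρ]
    split_ifs with hi
    · rw [hi]
    · rw [hΞX i hi, subst_X hκs, hκ, if_pos hi]
  have hρP : subst ρ P = 0 := by
    rw [← hρΞ, ← subst_comp_subst_apply hΞs hκs, hΞP, subst_X hκs, hκ, if_neg (fun h => h rfl)]
  -- the shear `τ = (x', y + φ)` and `G = F ∘ τ`
  obtain ⟨τ, hτ⟩ : ∃ τ : Fin (m + 1) → MvPowerSeries (Fin (m + 1)) k,
      ∀ i, τ i = if i = Fin.last m then X (Fin.last m) + φ else X i := ⟨_, fun _ => rfl⟩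
  have hτ0 : ∀ i, constantCoeff (τ i) = 0 := fun i => by
    rw [hτ]
    split_ifs <;> simp [constantCoeff_X, hφ0]
  have hτs : HasSubst τ := hasSubst_of_constantCoeff_zero hτ0
  set G := subst τ F with hG
  have hGo : ((e + 2 : ℕ) : ℕ∞) ≤ G.order := ConeDichotomy.le_order_subst_of_le τ hτ0 F _ hFo
  -- NO `y^{e+1}`-SLICE (Hasse slice + `P(x', φ) = 0`)
  have hslice : ∀ β : Fin (m + 1) →₀ ℕ, β (Fin.last m) = 0 →
      coeff (β + Finsupp.single (Fin.last m) (e + 1)) G = 0 := fun β hβ => by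
    rw [hG, coeff_shear_slice hφy hφ0 hτ hρ (e + 1) hP hβ, hρP, map_zero]
  -- pure `y`-coefficients are unchanged (restrict to the `y`-axis `π`)
  obtain ⟨π, hπ⟩ : ∃ π : Fin (m + 1) → MvPowerSeries (Fin (m + 1)) k,
      ∀ i, π i = if i = Fin.last m then X i else 0 := ⟨_, fun _ => rfl⟩
  have hπs : HasSubst π := CriticalSection.hasSubst_indSubst hπ
  have hπG : subst π G = subst π F := by
    rw [hG, subst_comp_subst_apply hτs hπs]
    congr 1
    funext i
    rw [hτ]
    split_ifs with hi
    · rw [subst_add hπs, subst_X hπs, hφdef,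
        CriticalSection.subst_indSubst_subst_indSubst_of_disjoint hκ hπ (fun j hj => hj) (hΞ0 _), add_zero, hi]
    · rw [subst_X hπs]
  have hpure : ∀ n, coeff (Finsupp.single (Fin.last m) n) G = coeff (Finsupp.single (Fin.last m) n) F := by
    intro n
    have hsupp : ∀ i ∈ (Finsupp.single (Fin.last m) n).support, i = Fin.last m := fun i hi =>
      Finset.mem_singleton.mp (Finsupp.support_single_subset hi)
    rw [← CriticalSection.coeff_subst_indSubst_of_forall hπ G hsupp, hπG,
      CriticalSection.coeff_subst_indSubst_of_forall hπ F hsupp]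
  -- COLLECT: `U = Σ_{n ≥ e+2} G_{·,n} y^{n-e-2}`, `a_j = G_{·,j}`
  obtain ⟨U, hU⟩ : ∃ U : MvPowerSeries (Fin (m + 1)) k,
      ∀ E, coeff E U = coeff (E + Finsupp.single (Fin.last m) (e + 2)) G :=
    ⟨fun E => coeff (E + Finsupp.single (Fin.last m) (e + 2)) G, fun _ => rfl⟩
  obtain ⟨a, ha⟩ : ∃ a : Fin (e + 1) → MvPowerSeries (Fin m) k, ∀ (j : Fin (e + 1)) (β : Fin m →₀ ℕ),
      coeff β (a j) = coeff (Finsupp.embDomain (Fin.succAboveEmb (Fin.last m)) β +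
        Finsupp.single (Fin.last m) (j : ℕ)) G :=
    ⟨fun j β =>
      coeff (Finsupp.embDomain (Fin.succAboveEmb (Fin.last m)) β + Finsupp.single (Fin.last m) (j : ℕ)) G,
      fun _ _ => rfl⟩
  refine ⟨φ, τ, U, a, hφy, hφ0, hτ, ?_, ?_, ?_⟩
  · -- `U(0) = c ≠ 0`
    rw [← coeff_zero_eq_constantCoeff_apply, hU, zero_add, hpure]
    exact hc
  · -- `Bad a`: `ord G ≥ e + 2`
    intro j
    right
    refine nat_le_order fun β hβ => ?_
    rw [ha]
    apply coeff_of_lt_order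
    refine lt_of_lt_of_le ?_ hGo
    rw [degree_emb_add_single]
    have := TupleGame.marking_add_val e j
    exact_mod_cast (by omega : β.degree + (j : ℕ) < e + 2)
  · -- `G = germ U a`, coefficient by coefficient at `x'^β y^n`
    ext E
    obtain ⟨β, hE⟩ := exists_eq_emb_add_single E
    rw [hE]
    set n := E (Fin.last m) with hn
    have hC1 : coeff (Finsupp.embDomain (Fin.succAboveEmb (Fin.last m)) β + Finsupp.single (Fin.last m) n)
        (U * X (Fin.last m) ^ (e + 2)) = if e + 2 ≤ n then
          coeff (Finsupp.embDomain (Fin.succAboveEmb (Fin.last m)) β + Finsupp.single (Fin.last m) n) G else 0 := by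
      rw [coeff_emb_add_single_mul_X_pow]
      split_ifs with h
      · rw [hU, emb_add_single_add_single, Nat.sub_add_cancel h]
      · rfl
    have hC2 : ∀ j : Fin (e + 1),
        coeff (Finsupp.embDomain (Fin.succAboveEmb (Fin.last m)) β + Finsupp.single (Fin.last m) n)
          (rename (Fin.succAboveEmb (Fin.last m)) (a j) * X (Fin.last m) ^ (j : ℕ)) = if (j : ℕ) = n then
          coeff (Finsupp.embDomain (Fin.succAboveEmb (Fin.last m)) β + Finsupp.single (Fin.last m) n) G else 0 := by
      intro j
      rw [coeff_emb_add_single_mul_X_pow]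
      by_cases hj : (j : ℕ) = n
      · rw [if_pos hj.le, if_pos hj, coeff_emb_add_single_rename, if_pos (by omega), ha, hj]
      · rw [if_neg hj]
        split_ifs with hle
        · rw [coeff_emb_add_single_rename, if_neg (by omega)]
        · rfl
    unfold TupleGame.germ
    rw [map_add, map_sum, hC1, Finset.sum_congr rfl (fun j _ => hC2 j),
      Fin.sum_univ_eq_sum_range (fun i => if i = n then
        coeff (Finsupp.embDomain (Fin.succAboveEmb (Fin.last m)) β + Finsupp.single (Fin.last m) n) G else 0) (e + 1),
      Finset.sum_ite_eq']
    rcases Nat.lt_or_ge n (e + 1) with h | h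
    · rw [if_neg (by omega), if_pos (Finset.mem_range.mpr h), zero_add]
    · rw [if_neg (fun h' => absurd (Finset.mem_range.mp h') (by omega))]
      rcases h.eq_or_lt with h' | h'
      · rw [if_neg (by omega), add_zero, ← h']
        exact hslice _ (embDomain_last β)
      · rw [if_pos (by omega), add_zero]

end TschirnhausForm

/-- Stub `stub_tschirnhausForm` of the skeleton `LocalWeightedDrop` (line `hasse-ridge-face-selection`):
TSCHIRNHAUS (MAXIMAL CONTACT) FORM FOR A TAME MULTIPLICITY.  Over an algebraically closed field of characteristic
`p`, a singular germ `f ∈ k[[x_0..x_m]]` of order `e + 2` with `p ∤ e + 2` becomes, after a legal coordinate change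
`θ`, a prepared germ `U · y^{e+2} + Σ_{j ≤ e} a_j(x') · y^j` (`y = X (Fin.last m)`, `U(0) ≠ 0`, no `y^{e+1}`
term) with a BAD coefficient tuple `a`. -/
theorem stub_tschirnhausForm : ∀ (p : ℕ), p.Prime → ∀ (k : Type) [Field k] [CharP k p] [IsAlgClosed k]
    (m e : ℕ) (f : MvPowerSeries (Fin (m + 1)) k), CobordantGame.IsSingular k f →
    f.order = ((e + 2 : ℕ) : ℕ∞) → ¬ p ∣ (e + 2) →
    ∃ (θ : Fin (m + 1) → MvPowerSeries (Fin (m + 1)) k) (U : MvPowerSeries (Fin (m + 1)) k)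
      (a : Fin (e + 1) → MvPowerSeries (Fin m) k),
      (∀ i, MvPowerSeries.constantCoeff (θ i) = 0) ∧
      IsUnit (Matrix.det (Matrix.of fun i j => MvPowerSeries.coeff (Finsupp.single j 1) (θ i))) ∧
      MvPowerSeries.constantCoeff U ≠ 0 ∧ TupleGame.Bad a ∧
      MvPowerSeries.subst θ f = TupleGame.germ U a := by
  intro p _ k _ _ _ m e f hf hfd hpd
  have he : ((e + 2 : ℕ) : k) ≠ 0 := fun h => hpd ((CharP.cast_eq_zero_iff k p _).mp h)
  obtain ⟨M, hMdet, hc⟩ := TschirnhausForm.exists_linSubst_coeff_ne_zero f hf.1 hfd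
  have hL0 : ∀ i, MvPowerSeries.constantCoeff (FormalCoordChange.linSubst M i) = 0 :=
    ConeDichotomy.constantCoeff_linSubst M
  have hFo : ((e + 2 : ℕ) : ℕ∞) ≤ (MvPowerSeries.subst (FormalCoordChange.linSubst M) f).order :=
    ConeDichotomy.le_order_subst_of_le _ hL0 f _ hfd.symm.le
  obtain ⟨φ, τ, U, a, hφy, hφ0, hτ, hU, hBad, hgerm⟩ :=
    TschirnhausForm.exists_shear_germ e he (MvPowerSeries.subst (FormalCoordChange.linSubst M) f) hFo hc
  have hτ0 : ∀ i, MvPowerSeries.constantCoeff (τ i) = 0 := fun i => by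
    rw [hτ]
    split_ifs <;> simp [MvPowerSeries.constantCoeff_X, hφ0]
  have hτs : MvPowerSeries.HasSubst τ := MvPowerSeries.hasSubst_of_constantCoeff_zero hτ0
  refine ⟨fun i => MvPowerSeries.subst τ (FormalCoordChange.linSubst M i), U, a,
    fun i => MvPowerSeries.constantCoeff_subst_eq_zero hτs hτ0 (hL0 i), ?_, hU, hBad, ?_⟩
  · -- linear part `M · T`, `T` unipotent lower-triangular
    rw [TschirnhausForm.linMat_subst τ hτ0 (FormalCoordChange.linSubst M), Matrix.det_mul,
      ConeDichotomy.linMat_linSubst,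
      TschirnhausForm.det_of_offLast_rows (Matrix.of fun l j => MvPowerSeries.coeff (Finsupp.single j 1) (τ l))]
    · rw [Matrix.of_apply, hτ, if_pos rfl, map_add, MvPowerSeries.coeff_index_single_self_X,
        hφy _ (by rw [Finsupp.single_eq_same]; exact one_ne_zero), add_zero, mul_one]
      exact hMdet
    · intro l j hl
      rw [Matrix.of_apply, hτ, if_neg hl, MvPowerSeries.coeff_index_single_X]
  · rw [← hgerm, MvPowerSeries.subst_comp_subst_apply (FormalCoordChange.hasSubst_linSubst M) hτs]

end Summit.ResolutionOfSingularities.ResolutionOfSingularities.Theorems
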